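import Summits.Ventures.PercRepro.Night2LocalForm

/-!
# PercRepro — fractional matchings for the local form, and the 2-adic part inequality (night-2, gen 6)

Two tools for typing the paper proofs of the local form (`proofs/NIGHT-2-local.md` §7–§8):

* **`card_shadowAt_ge_of_weights`** — a fractional matching certifies the local inequality: if the weights
  `w B S` have every column sum `Σ_{B ∈ membersIn} w B S ≤ 1` over the shadow sets `S` with closure `G` and every row
  sum `Σ_{S ∈ shadowAt} w B S` at least the demand `f B`, then `Σ_{B ∈ membersIn 𝒜 G} f B ≤ #shadowAt 𝒜 G`
  (nonnegativity of `w` is not even needed for the count);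
  `localShadowHall_of_weights` specialises `f` to the local weights.
* **`sum_two_pow_le_two_pow`** — for natural numbers `t_i ≥ 1` indexed by a finset with at least two elements,
  `Σ_i 2^{t_i} ≤ 2^{Σ_i t_i}` (the inequality behind the load bound of the line statement: the parts
  `t_i = |T ∩ P_i|` of a spanning set of a line satisfy `Σ_i 2^{t_i − |T|} ≤ 1`).
-/

namespace PercRepro.Shadow

open Finset PerFlat ThmH

variable {α : Type*} [DecidableEq α] {M : Matroid α} [M.Finite]

/-! ## Fractional matchings certify the local inequality -/

open scoped Classical in
/-- **A fractional matching certifies the local count.** -/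
theorem card_shadowAt_ge_of_weights {p q : ℕ} {𝒜 : Finset (Finset α)} {G : Finset α}
    (w : Finset α → Finset α → ℚ) (f : Finset α → ℚ)
    (hcol : ∀ S ∈ shadowAt M p q 𝒜 G, ∑ B ∈ membersIn M 𝒜 G, w B S ≤ 1)
    (hrow : ∀ B ∈ membersIn M 𝒜 G, f B ≤ ∑ S ∈ shadowAt M p q 𝒜 G, w B S) :
    ∑ B ∈ membersIn M 𝒜 G, f B ≤ ((shadowAt M p q 𝒜 G).card : ℚ) := by
  calc ∑ B ∈ membersIn M 𝒜 G, f B ≤ ∑ B ∈ membersIn M 𝒜 G, ∑ S ∈ shadowAt M p q 𝒜 G, w B S :=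
        Finset.sum_le_sum hrow
    _ = ∑ S ∈ shadowAt M p q 𝒜 G, ∑ B ∈ membersIn M 𝒜 G, w B S := Finset.sum_comm
    _ ≤ ∑ _S ∈ shadowAt M p q 𝒜 G, (1 : ℚ) := Finset.sum_le_sum hcol
    _ = ((shadowAt M p q 𝒜 G).card : ℚ) := by simp

open scoped Classical in
/-- **The local form from a fractional matching with the local weights as demands.** -/
theorem localShadowHall_of_weights {q : ℕ} {G : Finset α}
    (hmatch : ∀ 𝒜 ⊆ Uq M (q + 2) q, ∃ w : Finset α → Finset α → ℚ,
      (∀ B S, 0 ≤ w B S) ∧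
      (∀ S ∈ shadowAt M (q + 2) q 𝒜 G, ∑ B ∈ membersIn M 𝒜 G, w B S ≤ 1) ∧
      (∀ B ∈ membersIn M 𝒜 G,
        (((q : ℚ) + 2) / ((q : ℚ) + 1)) * localWeight M B G ≤ ∑ S ∈ shadowAt M (q + 2) q 𝒜 G, w B S)) :
    LocalShadowHall M q G := by
  intro 𝒜 h𝒜
  obtain ⟨w, -, hcol, hrow⟩ := hmatch 𝒜 h𝒜
  rw [Finset.mul_sum]
  exact card_shadowAt_ge_of_weights w (fun B => (((q : ℚ) + 2) / ((q : ℚ) + 1)) * localWeight M B G) hcol hrow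

/-! ## The 2-adic part inequality -/

omit [DecidableEq α] in
/-- `2^a + 2^b ≤ 2^(a + b)` for `a, b ≥ 1`. -/
theorem two_pow_add_two_pow_le {a b : ℕ} (ha : 1 ≤ a) (hb : 1 ≤ b) : 2 ^ a + 2 ^ b ≤ 2 ^ (a + b) := by
  obtain ⟨a', rfl⟩ : ∃ a', a = a' + 1 := ⟨a - 1, by omega⟩
  obtain ⟨b', rfl⟩ : ∃ b', b = b' + 1 := ⟨b - 1, by omega⟩
  have h1 : 1 ≤ 2 ^ a' := Nat.one_le_two_pow
  have h2 : 1 ≤ 2 ^ b' := Nat.one_le_two_pow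
  calc 2 ^ (a' + 1) + 2 ^ (b' + 1) = 2 * 2 ^ a' + 2 * 2 ^ b' := by ring
    _ ≤ 4 * (2 ^ a' * 2 ^ b') := by nlinarith
    _ = 2 ^ (a' + 1 + (b' + 1)) := by ring

omit [DecidableEq α] in
/-- **The 2-adic part inequality**: for parts `t i ≥ 1` over a finset `s` with at least two elements,
`Σ_{i ∈ s} 2^(t i) ≤ 2^(Σ_{i ∈ s} t i)`. -/
theorem sum_two_pow_le_two_pow {ι : Type*} [DecidableEq ι] (s : Finset ι) (t : ι → ℕ)
    (ht : ∀ i ∈ s, 1 ≤ t i) (hs : 2 ≤ s.card) : ∑ i ∈ s, 2 ^ (t i) ≤ 2 ^ (∑ i ∈ s, t i) := by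
  induction s using Finset.strongInduction with
  | H s ih =>
    obtain ⟨i, hi⟩ : s.Nonempty := Finset.card_pos.1 (by omega)
    have hrest : (s.erase i).Nonempty := by
      rw [← Finset.card_pos, Finset.card_erase_of_mem hi]; omega
    rw [← Finset.add_sum_erase s _ hi, ← Finset.add_sum_erase s t hi]
    have hti : 1 ≤ t i := ht i hi
    rcases Nat.lt_or_ge (s.erase i).card 2 with hlt | hge
    · -- exactly one other element j
      obtain ⟨j, hj⟩ := hrest
      have hcard : (s.erase i).card = 1 := by
        have := Finset.card_pos.2 ⟨j, hj⟩; omega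
      obtain ⟨k, hk⟩ := Finset.card_eq_one.1 hcard
      rw [hk, Finset.sum_singleton, Finset.sum_singleton]
      have hkmem : k ∈ s := Finset.mem_of_mem_erase (hk ▸ Finset.mem_singleton_self k)
      exact two_pow_add_two_pow_le hti (ht k hkmem)
    · have hrec := ih (s.erase i) (Finset.erase_ssubset hi) (fun j hj => ht j (Finset.mem_of_mem_erase hj)) hge
      have hsum : 1 ≤ ∑ j ∈ s.erase i, t j := by
        obtain ⟨j, hj⟩ := hrest
        calc 1 ≤ t j := ht j (Finset.mem_of_mem_erase hj)
          _ ≤ ∑ j ∈ s.erase i, t j := Finset.single_le_sum (fun _ _ => Nat.zero_le _) hj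
      calc 2 ^ t i + ∑ j ∈ s.erase i, 2 ^ t j ≤ 2 ^ t i + 2 ^ (∑ j ∈ s.erase i, t j) := by omega
        _ ≤ 2 ^ (t i + ∑ j ∈ s.erase i, t j) := two_pow_add_two_pow_le hti hsum

end PercRepro.Shadow
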